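import Summits.Ventures.PercRepro.C026Contract
import Summits.Ventures.PercRepro.GZSwapA

/-!
# Adding an edge: `H = G + e`, its deletion `H − e = G` and its contraction `H / e`, and mine-3's
# deletion–contraction identity DC-SUB (p5, gen 15)

mine-3 (`proofs/MINE3-FLIPS.md` §2, memo §23): for an edge `e = uv` of a marked multigraph `H` and `G := H − e`,
`Δ_CF(H) = Δ_CF(H − e) + Δ_CF(H / e) − #DB(e)`, where `Δ_CF(G) = #ab|c + #ac|b + #bc|a − #N_AB` is the C-026
slack (`slackCF`) and `DB(e)` is the defect set (`DCDefect`, C026DefectFlips).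

Here `H` is `G.addEdge u v : MultiGraph V (Option E)` — `G` with the extra edge `none = uv` — and `H / e` is
`G.contract u v` (C026Contract). A configuration of `H` is a configuration of `G` plus the state of `e`
(`extendOpt s ω`); on the slice `e` CLOSED the open events of `H` are those of `G` and its closed events those of
`H / e`, on the slice `e` OPEN the open events are those of `H / e` and the closed events those of `G`
(`conn_addEdge_closed_iff`, `conn_addEdge_open_iff`, `compl_extendOpt`, `conn_contract_iff`). Summing the two
slices (`card_filter_option`) and a four-case indicator identity (`indicator_identity`: `DB(e)` is exactly the
set where `a ~ b` only in `H / e` and the closed cluster of `c` misses `a, b` only in `G`) give **`slackCF_addEdge`**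
(DC-SUB) for every non-loop edge `e = uv` with `u` not a mark.
-/

namespace PercRepro

open Finset

namespace MultiGraph

section AddEdge

variable {V E : Type*}

/-- A configuration of `G` extended by the state `s` of the new edge `none`. -/
def extendOpt (s : Bool) (ω : Config E) : Config (Option E) := fun
  | none => s
  | some e => ω e

/-- A configuration of `H = G + e` restricted to the edges of `G`. -/
def restrictOpt (τ : Config (Option E)) : Config E := fun e => τ (some e)

/-- The state of the new edge. -/
@[simp] theorem extendOpt_none (s : Bool) (ω : Config E) : extendOpt s ω none = s := rfl

/-- The state of an old edge. -/
@[simp] theorem extendOpt_some (s : Bool) (ω : Config E) (e : E) : extendOpt s ω (some e) = ω e := rfl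

/-- Restricting an extension. -/
@[simp] theorem restrictOpt_extendOpt (s : Bool) (ω : Config E) :
    restrictOpt (extendOpt s ω) = ω := rfl

/-- Extending a restriction. -/
theorem extendOpt_restrictOpt (τ : Config (Option E)) :
    extendOpt (τ none) (restrictOpt τ) = τ := by
  funext e
  cases e <;> rfl

/-- The complement of an extension is the extension of the complement by the opposite state. -/
theorem compl_extendOpt (s : Bool) (ω : Config E) : (extendOpt s ω)ᶜ = extendOpt (!s) ωᶜ := by
  funext e
  cases e with
  | none => rw [compl_apply_not]; rfl
  | some e => rw [compl_apply_not, extendOpt_some, extendOpt_some, compl_apply_not]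

variable (G : MultiGraph V E)

/-- `H = G + e`: the multigraph with one more edge `e = uv`, the edge `none` of `Option E`. -/
def addEdge (u v : V) : MultiGraph V (Option E) where
  fst
    | none => u
    | some e => G.fst e
  snd
    | none => v
    | some e => G.snd e

/-- The endpoints of the new edge and of the old ones. -/
@[simp] theorem addEdge_fst_none (u v : V) : (G.addEdge u v).fst none = u := rfl

/-- The second endpoint of the new edge. -/
@[simp] theorem addEdge_snd_none (u v : V) : (G.addEdge u v).snd none = v := rfl

/-- The first endpoint of an old edge. -/
@[simp] theorem addEdge_fst_some (u v : V) (e : E) : (G.addEdge u v).fst (some e) = G.fst e := rfl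

/-- The second endpoint of an old edge. -/
@[simp] theorem addEdge_snd_some (u v : V) (e : E) : (G.addEdge u v).snd (some e) = G.snd e := rfl

variable {G}

/-- **Open adjacency of `H` with `e` closed** is open adjacency of `G`. -/
theorem openAdj_addEdge_closed_iff {u v : V} {ω : Config E} {x y : V} :
    (G.addEdge u v).OpenAdj (extendOpt false ω) x y ↔ G.OpenAdj ω x y := by
  constructor
  · rintro ⟨e, he, hend⟩
    cases e with
    | none => exact absurd he (by simp)
    | some e =>
      simp only [addEdge_fst_some, addEdge_snd_some] at hend
      exact ⟨e, he, hend⟩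
  · rintro ⟨e, he, hend⟩
    exact ⟨some e, he, by simpa only [addEdge_fst_some, addEdge_snd_some] using hend⟩

/-- **Connectivity of `H` with `e` closed** is connectivity of `G`. -/
theorem conn_addEdge_closed_iff {u v : V} {ω : Config E} {x y : V} :
    (G.addEdge u v).Conn (extendOpt false ω) x y ↔ G.Conn ω x y := by
  have h : (G.addEdge u v).OpenAdj (extendOpt false ω) = G.OpenAdj ω := by
    funext x y
    exact propext openAdj_addEdge_closed_iff
  unfold Conn
  rw [h]

/-- An open edge of `G` is an open edge of `H` (any state of `e`). -/
theorem conn_addEdge_of_conn {u v : V} {s : Bool} {ω : Config E} {x y : V} (h : G.Conn ω x y) :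
    (G.addEdge u v).Conn (extendOpt s ω) x y := by
  unfold Conn at h ⊢
  induction h with
  | refl => exact Relation.ReflTransGen.refl
  | tail _ hbc ih =>
    obtain ⟨e, he, hend⟩ := hbc
    exact ih.tail ⟨some e, he, by simpa only [addEdge_fst_some, addEdge_snd_some] using hend⟩

/-- **Connectivity of `H` with `e` open**: a path of `G`, or both ends joined in `G` to `u` or to `v`. -/
theorem conn_addEdge_open_iff {u v : V} {ω : Config E} {x y : V} :
    (G.addEdge u v).Conn (extendOpt true ω) x y ↔
      G.Conn ω x y ∨ ((G.Conn ω x u ∨ G.Conn ω x v) ∧ (G.Conn ω y u ∨ G.Conn ω y v)) := by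
  constructor
  · intro h
    refine Conn.induction
      (motive := fun z => G.Conn ω x z ∨ ((G.Conn ω x u ∨ G.Conn ω x v) ∧ (G.Conn ω z u ∨ G.Conn ω z v)))
      (Or.inl (Conn.refl G ω x)) ?_ h
    intro z z' _ hzz' ih
    obtain ⟨e, he, hend⟩ := hzz'
    cases e with
    | none =>
      -- the new edge: `{z, z'} = {u, v}`
      simp only [addEdge_fst_none, addEdge_snd_none] at hend
      have htz : G.Conn ω z u ∨ G.Conn ω z v := by
        rcases hend with ⟨h1, _⟩ | ⟨_, h2⟩
        · exact Or.inl (by rw [← h1]; exact Conn.refl G ω u)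
        · exact Or.inr (by rw [← h2]; exact Conn.refl G ω v)
      have htz' : G.Conn ω z' u ∨ G.Conn ω z' v := by
        rcases hend with ⟨_, h2⟩ | ⟨h1, _⟩
        · exact Or.inr (by rw [← h2]; exact Conn.refl G ω v)
        · exact Or.inl (by rw [← h1]; exact Conn.refl G ω u)
      refine Or.inr ⟨?_, htz'⟩
      rcases ih with hxz | hxz
      · exact touch_of_conn hxz.symm htz
      · exact hxz.1
    | some e =>
      simp only [addEdge_fst_some, addEdge_snd_some] at hend
      have hzz' : G.Conn ω z z' := Conn.of_openAdj ⟨e, he, hend⟩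
      rcases ih with hxz | hxz
      · exact Or.inl (hxz.trans hzz')
      · exact Or.inr ⟨hxz.1, touch_of_conn hzz' hxz.2⟩
  · rintro (h | ⟨hx, hy⟩)
    · exact conn_addEdge_of_conn h
    · have huv : (G.addEdge u v).Conn (extendOpt true ω) u v :=
        Conn.of_openAdj ⟨none, rfl, Or.inl ⟨rfl, rfl⟩⟩
      have hxv : (G.addEdge u v).Conn (extendOpt true ω) x v := by
        rcases hx with hx | hx
        · exact (conn_addEdge_of_conn hx).trans huv
        · exact conn_addEdge_of_conn hx
      have hyv : (G.addEdge u v).Conn (extendOpt true ω) y v := by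
        rcases hy with hy | hy
        · exact (conn_addEdge_of_conn hy).trans huv
        · exact conn_addEdge_of_conn hy
      exact hxv.trans hyv.symm

/-- **Connectivity in the contraction** (`v ≠ u`, ends `≠ u`): a path of `G`, or both ends joined in `G` to `u`
or to `v` — the same as connectivity of `H` with `e` open. -/
theorem conn_contract_iff {u v : V} (huv : v ≠ u) {ω : Config E} {x y : V} (hx : x ≠ u) (hy : y ≠ u) :
    (G.contract u v).Conn ω x y ↔
      G.Conn ω x y ∨ ((G.Conn ω x u ∨ G.Conn ω x v) ∧ (G.Conn ω y u ∨ G.Conn ω y v)) := by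
  constructor
  · exact conn_contract_imp
  · rintro (h | ⟨hx', hy'⟩)
    · exact conn_contract_of_conn_of_ne hx hy h
    · exact ((conn_contract_merged_iff huv hx).mpr hx').trans
        ((conn_contract_merged_iff huv hy).mpr hy').symm

/-- Connectivity of `H` with `e` open is connectivity of `H / e` (`v ≠ u`, ends `≠ u`). -/
theorem conn_addEdge_open_iff_contract {u v : V} (huv : v ≠ u) {ω : Config E} {x y : V} (hx : x ≠ u)
    (hy : y ≠ u) : (G.addEdge u v).Conn (extendOpt true ω) x y ↔ (G.contract u v).Conn ω x y := by
  rw [conn_addEdge_open_iff, conn_contract_iff huv hx hy]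

/-- The closed connectivity of `H` with `e` closed is the closed connectivity of `H / e` (`e` is a closed edge
joining `u` and `v`). -/
theorem conn_compl_addEdge_closed_iff {u v : V} (huv : v ≠ u) {ω : Config E} {x y : V} (hx : x ≠ u)
    (hy : y ≠ u) : (G.addEdge u v).Conn (extendOpt false ω)ᶜ x y ↔ (G.contract u v).Conn ωᶜ x y := by
  rw [compl_extendOpt]
  exact conn_addEdge_open_iff_contract huv hx hy

/-- The closed connectivity of `H` with `e` open is the closed connectivity of `G`. -/
theorem conn_compl_addEdge_open_iff {u v : V} {ω : Config E} {x y : V} :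
    (G.addEdge u v).Conn (extendOpt true ω)ᶜ x y ↔ G.Conn ωᶜ x y := by
  rw [compl_extendOpt]
  exact conn_addEdge_closed_iff

/-! ### Counting over the two slices -/

/-- The cube of `H` is the disjoint union of the two slices `e` closed / `e` open: every count over `H`'s
configurations is the sum of the counts over the two extensions. -/
theorem card_filter_option [Fintype E] [DecidableEq E] (Q : Config (Option E) → Prop) [DecidablePred Q] :
    (univ.filter Q).card =
      (univ.filter fun ω : Config E => Q (extendOpt false ω)).card +
        (univ.filter fun ω : Config E => Q (extendOpt true ω)).card := by
  classical
  have h : (univ.filter Q).card =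
      ((univ : Finset (Bool × Config E)).filter fun p => Q (extendOpt p.1 p.2)).card := by
    refine Finset.card_nbij' (fun τ => (τ none, restrictOpt τ)) (fun p => extendOpt p.1 p.2) ?_ ?_ ?_ ?_
    · intro τ hτ
      simp only [Finset.coe_filter, Finset.mem_univ, true_and, Set.mem_setOf_eq] at hτ ⊢
      rw [extendOpt_restrictOpt]
      exact hτ
    · intro p hp
      simp only [Finset.coe_filter, Finset.mem_univ, true_and, Set.mem_setOf_eq] at hp ⊢
      exact hp
    · intro τ _
      exact extendOpt_restrictOpt τ
    · intro p _
      rfl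
  rw [h, ← Finset.univ_product_univ, Finset.card_filter, Finset.sum_product, Fintype.sum_bool,
    ← Finset.card_filter, ← Finset.card_filter, add_comm]

end AddEdge

end MultiGraph

end PercRepro
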